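import Summits.ValiantsHypothesis.ValiantsHypothesis.Theorems.BarrierLeverPartitionMinorsChowTwoEdgeStepDet

/-!
# Route BarrierLever — Chow witnesses for partition minors (item 20172, CPM): the TWO-EDGE STEP
# (a row coordinate with two edges against a column coordinate with two edges)

Helper file (`--supports stmt-ValiantsHypothesis-20172`; cell valiant-natproofs, rung V4, 𝒟-side of
door (c); seat val-np-p4 gen 13).  Closes NO item.  Conventions of items 19717 / 20172 / 20195: a
layout `(u, w)` of height `h` is HIT when some product of `h + h` affine forms has nonsingular
partition minor `det[coeff_{E (u i) (w j)} ∏ ℓ]`.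

**The two-edge step (`chow_twoEdgeStep`).**  Height `h + 1`, size `r + 2`.  The rows carry two edges
in direction `a`: `u v₀ = (u v₁).erase a`, `u v₀' = (u v₂).erase a` with `a ∈ u v₁`, `a ∈ u v₂`
(`v₂ = v₁.succAbove v₂''`); the columns two edges in direction `c`: `w j₀ = (w j₁).erase c`,
`w j₀' = (w j₂).erase c` (`j₂ = j₁.succAbove j₂''`); literal-class sizes arbitrary.  If the reduced
layout of height `h` and size `r` (drop rows `v₁, v₂` and columns `j₁, j₂`; delete `a`, `c`; pull
back) is hit AND the `2 × 2` base layout `(u v₀, u v₀') × (w j₀, w j₀')` (pulled back) is hit, then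
`(u, w)` is hit.  The `m = 1` member of this family is the edge step `chow_edgeStep`; in the engine
the two-edge step forbids, for a minimal unhit layout, a row coordinate and a column coordinate that
both carry EXACTLY TWO edges («edge-count profiles share no value `2`»).  Census (kit, exact): the
step applies to `16 992` of the `21 600` `(4,7)` cores — all of which survive the leaf, edge and
double steps, since the six «two squares through a point» row classes `{∅,0,1,01,2,3,23}` carry two
edges in every direction — and to `2 640` of the `6 512` `(4,6)` survivors.

Proof: common witness for the reduced layout and the base layout (`exists_common_chow_witness₂`),
lifted along `(a, c)`; gadget `g_t = (1 + x_a + (1−t) y_c)(1 + t y_c)` (`coeff_edgeGadget`);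
`M(t) i j = t^{[a ∈ u i][c ∈ w j]} · F i j` (`coeff_partitionExpo_mul_pairFactor`); the parameter from
`exists_det_twoEdge_ne_zero` (`…ChowTwoEdgeStepDet`).

WHAT THIS IS NOT: a reduction step; nothing on items 20172 / 20195 / 19717 themselves, on crux
stmt-ValiantsHypothesis-14610, or on `VP` versus `VNP`.
-/

set_option linter.dupNamespace false

namespace Summit.ValiantsHypothesis.ValiantsHypothesis.Theorems.BarrierLever.ChowFactor

open Finset MvPolynomial

noncomputable section

variable {h : ℕ}

/-- **THE TWO-EDGE STEP for Chow witnesses.**  See the module docstring. -/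
theorem chow_twoEdgeStep (a c : Fin (h + 1)) {r : ℕ} (u w : Fin (r + 2) → Finset (Fin (h + 1)))
    (v₀ v₀' v₁ : Fin (r + 2)) (v₂'' : Fin (r + 1)) (j₀ j₀' j₁ : Fin (r + 2)) (j₂'' : Fin (r + 1))
    (ha₁ : a ∈ u v₁) (ha₂ : a ∈ u (v₁.succAbove v₂'')) (hv₀ : u v₀ = (u v₁).erase a)
    (hv₀' : u v₀' = (u (v₁.succAbove v₂'')).erase a)
    (hj₀ : j₀ ≠ j₁) (hj₀' : j₀' ≠ j₁) (hj₀'₂ : j₀' ≠ j₁.succAbove j₂'')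
    (hc₁ : c ∈ w j₁) (hc₂ : c ∈ w (j₁.succAbove j₂'')) (hw₀ : w j₀ = (w j₁).erase c)
    (hw₀' : w j₀' = (w (j₁.succAbove j₂'')).erase c)
    (hred : ∃ ℓ : Fin (h + h) → MvPolynomial (Fin (h + h)) ℂ, (∀ q, (ℓ q).totalDegree ≤ 1) ∧
      (Matrix.of fun k l : Fin r => coeff
        (∑ b ∈ (u (v₁.succAbove (v₂''.succAbove k))).preimage a.succAbove
            Fin.succAbove_right_injective.injOn, Finsupp.single (Fin.castAdd h b) 1 +
          ∑ d ∈ (w (j₁.succAbove (j₂''.succAbove l))).preimage c.succAbove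
            Fin.succAbove_right_injective.injOn, Finsupp.single (Fin.natAdd h d) 1)
        (∏ q, ℓ q)).det ≠ 0)
    (hbase : ∃ ℓ : Fin (h + h) → MvPolynomial (Fin (h + h)) ℂ, (∀ q, (ℓ q).totalDegree ≤ 1) ∧
      (Matrix.of fun k l : Fin 2 => coeff
        (∑ b ∈ (u (![v₀, v₀'] k)).preimage a.succAbove Fin.succAbove_right_injective.injOn,
            Finsupp.single (Fin.castAdd h b) 1 +
          ∑ d ∈ (w (![j₀, j₀'] l)).preimage c.succAbove Fin.succAbove_right_injective.injOn,
            Finsupp.single (Fin.natAdd h d) 1)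
        (∏ q, ℓ q)).det ≠ 0) :
    ∃ ℓ : Fin ((h + 1) + (h + 1)) → MvPolynomial (Fin ((h + 1) + (h + 1))) ℂ,
      (∀ q, (ℓ q).totalDegree ≤ 1) ∧
      (Matrix.of fun i j : Fin (r + 2) => coeff
        (∑ a' ∈ u i, Finsupp.single (Fin.castAdd (h + 1) a') 1 +
          ∑ c' ∈ w j, Finsupp.single (Fin.natAdd (h + 1) c') 1)
        (∏ q, ℓ q)).det ≠ 0 := by
  classical
  set v₂ := v₁.succAbove v₂'' with hv₂
  set j₂ := j₁.succAbove j₂'' with hj₂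
  obtain ⟨ℓ, hdeg, hA, hB⟩ := exists_common_chow_witness₂ _ _ _ _ hred hbase
  -- the coefficient matrix of the (future) lifted witness
  set F : Matrix (Fin (r + 2)) (Fin (r + 2)) ℂ := Matrix.of fun i j => coeff
      (∑ b ∈ (u i).preimage a.succAbove Fin.succAbove_right_injective.injOn,
          Finsupp.single (Fin.castAdd h b) 1 +
        ∑ d ∈ (w j).preimage c.succAbove Fin.succAbove_right_injective.injOn,
          Finsupp.single (Fin.natAdd h d) 1) (∏ q, ℓ q) with hFdef
  have ha₀ : a ∉ u v₀ := by rw [hv₀]; exact Finset.notMem_erase a _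
  have ha₀' : a ∉ u v₀' := by rw [hv₀']; exact Finset.notMem_erase a _
  have hc₀ : c ∉ w j₀ := by rw [hw₀]; exact Finset.notMem_erase c _
  have hc₀' : c ∉ w j₀' := by rw [hw₀']; exact Finset.notMem_erase c _
  have hrow₁ : ∀ j, F v₁ j = F v₀ j := fun j => by
    rw [hFdef, Matrix.of_apply, Matrix.of_apply, hv₀, preimage_succAbove_erase]
  have hrow₂ : ∀ j, F v₂ j = F v₀' j := fun j => by
    rw [hFdef, Matrix.of_apply, Matrix.of_apply, hv₀', preimage_succAbove_erase]
  have hcol₁ : ∀ i, F i j₁ = F i j₀ := fun i => by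
    rw [hFdef, Matrix.of_apply, Matrix.of_apply, hw₀, preimage_succAbove_erase]
  have hcol₂ : ∀ i, F i j₂ = F i j₀' := fun i => by
    rw [hFdef, Matrix.of_apply, Matrix.of_apply, hw₀', preimage_succAbove_erase]
  have hminor : (F.submatrix (fun k => v₁.succAbove (v₂''.succAbove k))
      (fun k => j₁.succAbove (j₂''.succAbove k))).det ≠ 0 := by
    have hsub : F.submatrix (fun k => v₁.succAbove (v₂''.succAbove k))
        (fun k => j₁.succAbove (j₂''.succAbove k)) = Matrix.of fun k l : Fin r => coeff
        (∑ b ∈ (u (v₁.succAbove (v₂''.succAbove k))).preimage a.succAbove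
            Fin.succAbove_right_injective.injOn, Finsupp.single (Fin.castAdd h b) 1 +
          ∑ d ∈ (w (j₁.succAbove (j₂''.succAbove l))).preimage c.succAbove
            Fin.succAbove_right_injective.injOn, Finsupp.single (Fin.natAdd h d) 1)
        (∏ q, ℓ q) := by
      ext k l; rw [Matrix.submatrix_apply, hFdef, Matrix.of_apply, Matrix.of_apply]
    rw [hsub]
    exact hA
  have hbase' : F v₀ j₀ * F v₀' j₀' - F v₀ j₀' * F v₀' j₀ ≠ 0 := by
    have e : (Matrix.of fun k l : Fin 2 => coeff
        (∑ b ∈ (u (![v₀, v₀'] k)).preimage a.succAbove Fin.succAbove_right_injective.injOn,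
            Finsupp.single (Fin.castAdd h b) 1 +
          ∑ d ∈ (w (![j₀, j₀'] l)).preimage c.succAbove Fin.succAbove_right_injective.injOn,
            Finsupp.single (Fin.natAdd h d) 1)
        (∏ q, ℓ q)) = !![F v₀ j₀, F v₀ j₀'; F v₀' j₀, F v₀' j₀'] := by
      ext k l
      fin_cases k <;> fin_cases l <;> rfl
    rw [e, Matrix.det_fin_two_of] at hB
    exact hB
  -- the parameter
  obtain ⟨t, ht⟩ := exists_det_twoEdge_ne_zero F (fun i => a ∈ u i) (fun j => c ∈ w j) v₀ v₀' v₁ v₂''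
    j₀ j₀' j₁ j₂'' ha₁ ha₀ ha₂ ha₀' hrow₁ hrow₂ hj₀ hj₀' hj₀'₂ hc₁ hc₂ hc₀ hc₀' hcol₁ hcol₂ hbase' hminor
  -- the lift and the gadget (as in the edge step)
  set L : Fin (h + h) → Fin ((h + 1) + (h + 1)) := Fin.append
    (fun b : Fin h => Fin.castAdd (h + 1) (a.succAbove b))
    (fun d : Fin h => Fin.natAdd (h + 1) (c.succAbove d)) with hL
  set f₁ : MvPolynomial (Fin ((h + 1) + (h + 1))) ℂ :=
    C 1 + C 1 * X (Fin.castAdd (h + 1) a) + C (1 - t) * X (Fin.natAdd (h + 1) c) with hf₁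
  set f₂ : MvPolynomial (Fin ((h + 1) + (h + 1))) ℂ :=
    C 1 + C 0 * X (Fin.castAdd (h + 1) a) + C t * X (Fin.natAdd (h + 1) c) with hf₂
  have hcard : (h + h) + 2 = (h + 1) + (h + 1) := by omega
  set e : Fin ((h + h) + 2) ≃ Fin ((h + 1) + (h + 1)) := finCongr hcard with he
  set ℓ' : Fin ((h + h) + 2) → MvPolynomial (Fin ((h + 1) + (h + 1))) ℂ :=
    Fin.append (fun q => rename L (ℓ q)) ![f₁, f₂] with hℓ'
  refine ⟨fun q => ℓ' (e.symm q), fun q => ?_, ?_⟩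
  · show (ℓ' (e.symm q)).totalDegree ≤ 1
    generalize e.symm q = q₀
    rw [hℓ']
    induction q₀ using Fin.addCases with
    | left q' =>
      rw [Fin.append_left]
      exact totalDegree_rename_le_one L (ℓ q') (hdeg q')
    | right q' =>
      rw [Fin.append_right]
      fin_cases q'
      · exact totalDegree_affine_xy_le a c 1 (1 - t)
      · exact totalDegree_affine_xy_le a c 0 t
  · have hprod : (∏ q, ℓ' (e.symm q)) = (f₁ * f₂) * rename L (∏ q, ℓ q) := by
      rw [Fintype.prod_equiv e.symm (fun q => ℓ' (e.symm q)) ℓ' (fun _ => rfl), hℓ',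
        Fin.prod_univ_add]
      simp only [Fin.append_left, Fin.append_right, Fin.prod_univ_two, Matrix.cons_val_zero,
        Matrix.cons_val_one]
      rw [map_prod, mul_comm]
    rw [hprod]
    have hentry : ∀ i j : Fin (r + 2), coeff
        (∑ a' ∈ u i, Finsupp.single (Fin.castAdd (h + 1) a') 1 +
          ∑ c' ∈ w j, Finsupp.single (Fin.natAdd (h + 1) c') 1) ((f₁ * f₂) * rename L (∏ q, ℓ q)) =
        (if a ∈ u i ∧ c ∈ w j then t else 1) * F i j := by
      intro i j
      rw [coeff_partitionExpo_mul_pairFactor _ _ a c (support_edgeGadget a c t)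
        (support_rename_lift a c _) (u i) (w j)]
      have hfa : (u i).filter (fun a' => a' = a) = u i ∩ {a} := by
        ext x; simp [Finset.mem_filter, Finset.mem_inter]
      have hfc : (w j).filter (fun c' => c' = c) = w j ∩ {c} := by
        ext x; simp [Finset.mem_filter, Finset.mem_inter]
      rw [hfa, hfc, coeff_edgeGadget a c t _ _ ?_ ?_, erase_eq_map_preimage_succAbove,
        erase_eq_map_preimage_succAbove, coeff_lift_rename, hFdef, Matrix.of_apply]
      · have hane : ({a} : Finset (Fin (h + 1))) ≠ ∅ := Finset.singleton_ne_empty a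
        have hcne : ({c} : Finset (Fin (h + 1))) ≠ ∅ := Finset.singleton_ne_empty c
        by_cases ha' : a ∈ u i <;> by_cases hc' : c ∈ w j <;>
          simp [Finset.inter_singleton_of_mem, Finset.inter_singleton_of_notMem, ha', hc',
            hane.symm, hcne.symm]
      · by_cases ha' : a ∈ u i
        · right; rw [Finset.inter_singleton_of_mem ha']
        · left; rw [Finset.inter_singleton_of_notMem ha']
      · by_cases hc' : c ∈ w j
        · right; rw [Finset.inter_singleton_of_mem hc']
        · left; rw [Finset.inter_singleton_of_notMem hc']
    have hM : (Matrix.of fun i j : Fin (r + 2) => coeff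
        (∑ a' ∈ u i, Finsupp.single (Fin.castAdd (h + 1) a') 1 +
          ∑ c' ∈ w j, Finsupp.single (Fin.natAdd (h + 1) c') 1) ((f₁ * f₂) * rename L (∏ q, ℓ q))) =
        Matrix.of fun i j => (if a ∈ u i ∧ c ∈ w j then t else 1) * F i j := by
      ext i j
      rw [Matrix.of_apply, hentry, Matrix.of_apply]
    rw [hM]
    exact ht

end

end Summit.ValiantsHypothesis.ValiantsHypothesis.Theorems.BarrierLever.ChowFactor
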